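import Summits.PneNP.PneNP.Theorems.ChebyshevTracialDesignExtendedSignSharp
import HarnessLib

/-!
# Cell pnp-psdrank, route `ChebyshevTracialDesign`: HIGH-PASS FIELDS ARE INVISIBLE TO AN EXACT DESIGN — a field on the odd cuts whose
# entrywise Johnson-harmonic layers of degree `≤ D` vanish has design value `|Σ W·tr(E_U Y_M)| ≤ (Σ|w_c|)·√(P_D·‖E‖²·‖Y‖²)` against EVERY
# matching side; hence two cut fields with the same low layers are priced alike, and the cells of the price list are to be read MODULO
# HIGH HARMONICS — a non-psd equivalence (crux `TracialDecayExp20`, stmt-PneNP-19878)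

Brick 95 (prover g18; MEMO-21 §2). Brick 20/22a (`…VirtualValueUnique.tracial_value_truncation_of_data`) says: for ANY cut field `X`, ANY
matching field `Y` and ANY harmonic datum `p` of the entries of `X` on the `t`-cuts, the design value is `−VV_D(p)/|PM|` up to
`(Σ|w_c|)·√(P_D·(N_X/C(n,t))·(N_Y/|PM|))` (`N` = Frobenius masses), and `VV_D(p)` involves ONLY the layers `p_j`, `j ≤ D`. Consequences:
* §1 **`abs_value_le_of_highPass`** — if `E` admits a harmonic datum with `p_j = 0` for all `j ≤ D` (a HIGH-PASS field: no entrywise Johnson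
  harmonics of degree `≤ D` on the `t`-cuts), then `VV_D = 0` and `|Σ_{U,M} W(U,M)·tr(E_U Y_M)| ≤ (Σ|w_c|)·√(P_D·(N_E/C(n,t))·(N_Y/|PM|))` —
  for EVERY `Y` (no positivity, no contraction hypothesis on either side; `E` may be indefinite).
* §1 **`abs_value_sub_le_of_highPass_sub`** — hence for ANY two cut fields `X, X'` whose difference is high-pass (datum of `X − X'` vanishing up
  to degree `D`): `|value(X,Y) − value(X',Y)| ≤ (Σ|w_c|)·√(P_D·(N_{X−X'}/C(n,t))·(N_Y/|PM|))`; for contraction fields this is `≤ 2·B_v·r·√P_D`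
  (`value_sub_le_of_highPass_sub_contractions`).
* §2 **`value_le_of_lowDegree_add_highPass`** — THE SIGN CELL MODULO HIGH HARMONICS: `X = A Aᵀ + E` with `A` of Johnson degree `≤ k`
  (`D ≤ k ≤ c'`, `A Aᵀ ⪯ I`) and `E` high-pass with `N_E ≤ ρ²·C(n,t)`: against every psd-contraction `Y`,
  `value(X,Y) ≤ r·(B_v√P_D + 2^{k+1}√P_k + Σ_{κ∈(D/2,k/2]} R_κ√A_κ) + B_v·ρ·√r·√P_D` (brick 94b + §1). `X` itself need be neither Gram of low degree
  nor even psd: the PARITY-MASKED SIGN-FEATURE fields of the fourth barrier (`Literature.Barriers.PneNP.GramMinorantLayerEnergy`: no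
  low-degree psd Gram MINORANT exists, so the psd-summand price list SIGN∞ ⊕ DOM ⊕ JUNK of brick 88c does not see them) are exactly of this
  shape on the slice once the mask parity has negligible low harmonics — `(1+χ_P)wwᵀ/2r = wwᵀ/2r + (high-pass)` — and are priced here.
WHY THIS MATTERS (MEMO-21 §1–§2): Gram DEGREE of a psd field is destroyed by any high-degree {0,1} amplitude (barrier 4), but the design value
only reads `X^{≤D}`; the robust currency is «`X^{≤D} = (low-degree Gram contraction)^{≤D}` up to Frobenius slack», not «`X` has a low-degree
Gram psd minorant». The equivalence `X ∼ X'` iff `(X − X')^{≤D} = 0` is NOT a psd-order relation, which is why MEMO-20 §1(b)'s rule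
('decompositions must be psd column groupings') was too strict: psd-ness is needed of the REPRESENTATIVE `X'`, not of the difference.
[cite: Rothvoss2017, §2 (PDF p. 6)] [cite: Grigoriev2001, Lemma 1.4 (PDF p. 8)] [cite: GriblingDelaatLaurent2019, §5]
[cite: LeePrakashDewolfYuen2016, App. B Thm. B.5, Cor. B.6]
Stature: support/instrument (kernel lane, no defs, axioms standard). WHAT THIS IS NOT: no statement about which fields ARE high-pass
equivalent to SIGN/DOM/JUNK representatives (that is the open decomposition question, now correctly typed), no proof or refutation of
`TracialDecayExp20`, nothing on psd rank of P_PM(K_n), no P-vs-NP content. Supports stmt-PneNP-19878.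
-/

set_option linter.dupNamespace false -- `Summit.PneNP.PneNP.…`: summit = sub-problem (D-0017)

noncomputable section

namespace Summit.PneNP.PneNP.Theorems.ChebyshevTracialDesignHighPassInvisible

open Finset Matrix Polynomial Literature.Barriers.PneNP Literature.Combinatorics.SimpleGraph.CycleSpace
open Literature.Computability.Complexity Literature.Combinatorics.Optimization
open Literature.Combinatorics.AssociationSchemes Literature.Combinatorics.AssociationSchemes.JohnsonHarmonics
open Literature.Combinatorics.AssociationSchemes.JohnsonSpectrum
open Summit.PneNP.PneNP.Theorems.ChebyshevTracialDesignTracialProfilePolynomial (sum_frobenius_cuts_le sum_frobenius_matchings_le)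
open Summit.PneNP.PneNP.Theorems.ChebyshevTracialDesignProfilePolynomial (card_pmatch_pos prod_atten_nonneg)
open Summit.PneNP.PneNP.Theorems.ChebyshevTracialDesignVirtualValueUnique (tracial_value_truncation_of_data)
open Summit.PneNP.PneNP.Theorems.ChebyshevTracialDesignExtendedSignSharp (value_le_of_lowDegree_allModes_sharp)
open scoped MatrixOrder

variable {n : ℕ}

/-! ### §1 High-pass fields have negligible design value against everything -/

/-- **HIGH-PASS FIELDS ARE INVISIBLE.** Let `(n, t = 2c'+1, T, D ≤ 2c', B_v, C, w)` be an exact design, `E` ANY `r × r`-matrix field on the odd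
cuts admitting a harmonic datum `p` on the `t`-cuts whose layers of degree `≤ D` vanish, and `Y` ANY matrix field on the perfect matchings.
Then `|Σ_{U,M} W(U,M)·tr(E_U Y_M)| ≤ (Σ_c|w_c|)·√(P_D·(N_E/C(n,t))·(N_Y/|PM|))`, `N_E = Σ_{|U|=t}‖E_U‖_F²`, `N_Y = Σ_M‖Y_M‖_F²`.
[cite: Rothvoss2017, §2 (PDF p. 6)] [cite: Grigoriev2001, Lemma 1.4 (PDF p. 8)] [cite: LeePrakashDewolfYuen2016, App. B Thm. B.5] -/
theorem abs_value_le_of_highPass {c' T D r : ℕ} {Bv : ℝ} {C : Finset ℕ} {w : ℕ → ℝ} (hn : Even n)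
    (hdes : IsExactDesign n (2 * c' + 1) T D Bv C w) (hD : D ≤ 2 * c')
    (E : OddSet n → Matrix (Fin r) (Fin r) ℝ) (Y : PMatch n → Matrix (Fin r) (Fin r) ℝ)
    (p : Fin r × Fin r → ℕ → Finset (Fin n) → ℝ) (hp : ∀ ab j, IsHarmonic j (p ab j))
    (hdec : ∀ ab (U : OddSet n), U.1.card = 2 * c' + 1 →
      E U ab.1 ab.2 = (∑ j ∈ range (2 * c' + 1 + 1), up^[2 * c' + 1 - j] (p ab j)) U.1)
    (hhigh : ∀ ab j, j ≤ D → p ab j = 0) :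
    |∑ U : OddSet n, ∑ M : PMatch n, levelWeight n (2 * c' + 1) C w U M * (E U * Y M).trace| ≤
      (∑ c ∈ C, |w c|) *
        Real.sqrt ((∏ i ∈ range (D / 2 + 1), ((2 * i + 1 : ℝ) / ((n : ℝ) - 2 * i))) *
          ((∑ U : OddSet n, if U.1.card = 2 * c' + 1 then ∑ a, ∑ b, E U a b ^ 2 else 0) / (n.choose (2 * c' + 1) : ℝ)) *
          ((∑ M : PMatch n, ∑ a, ∑ b, Y M a b ^ 2) / (Fintype.card (PMatch n) : ℝ))) := by
  have h := tracial_value_truncation_of_data hn hdes hD E Y p hp hdec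
  -- the truncated virtual value vanishes: every low layer is `0`, every high layer is cut
  have hzero : ∀ (A : Finset (Fin n)) (a b : Fin r),
      (∑ j ∈ range (2 * c' + 1 + 1), ((2 * c' + 1 - j).factorial : ℝ) • (if D < j then 0 else p (a, b) j)) A = 0 := by
    intro A a b
    rw [Finset.sum_apply]
    refine sum_eq_zero fun j _ => ?_
    by_cases hj : D < j
    · rw [if_pos hj, smul_zero, Pi.zero_apply]
    · rw [if_neg hj, hhigh (a, b) j (by omega), smul_zero, Pi.zero_apply]
  have hVV : (Fintype.card (PMatch n) : ℝ)⁻¹ * ∑ M : PMatch n, ∑ A : {A : Finset (Fin n) // A.card ≤ D},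
      (Matrix.of (fun a b : Fin r =>
        (∑ j ∈ range (2 * c' + 1 + 1), ((2 * c' + 1 - j).factorial : ℝ) • (if D < j then 0 else p (a, b) j)) A.1) * Y M).trace *
        knapsackMoment M.1.card (((2 * c' + 1 : ℕ) : ℝ) / 2) (M.1.filter fun e => ∃ a ∈ A.1, a ∈ e).card = 0 := by
    rw [sum_eq_zero fun M _ => sum_eq_zero fun A _ => ?_, mul_zero]
    have hM : (Matrix.of fun a b : Fin r =>
        (∑ j ∈ range (2 * c' + 1 + 1), ((2 * c' + 1 - j).factorial : ℝ) • (if D < j then 0 else p (a, b) j)) A.1) = 0 := by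
      ext a b; rw [Matrix.of_apply, hzero, Matrix.zero_apply]
    rw [hM, Matrix.zero_mul, trace_zero, zero_mul]
  rwa [hVV, add_zero] at h

/-- **HIGH-PASS EQUIVALENCE.** For ANY two cut fields `X, X'` whose difference `X − X'` is high-pass (a harmonic datum `p` of `X − X'` on the
`t`-cuts with vanishing layers of degree `≤ D`) and ANY matching field `Y`:
`|value(X,Y) − value(X',Y)| ≤ (Σ_c|w_c|)·√(P_D·(N_{X−X'}/C(n,t))·(N_Y/|PM|))`. [cite: Rothvoss2017, §2 (PDF p. 6)]
[cite: Grigoriev2001, Lemma 1.4 (PDF p. 8)] [cite: LeePrakashDewolfYuen2016, App. B Thm. B.5] -/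
theorem abs_value_sub_le_of_highPass_sub {c' T D r : ℕ} {Bv : ℝ} {C : Finset ℕ} {w : ℕ → ℝ} (hn : Even n)
    (hdes : IsExactDesign n (2 * c' + 1) T D Bv C w) (hD : D ≤ 2 * c')
    (X X' : OddSet n → Matrix (Fin r) (Fin r) ℝ) (Y : PMatch n → Matrix (Fin r) (Fin r) ℝ)
    (p : Fin r × Fin r → ℕ → Finset (Fin n) → ℝ) (hp : ∀ ab j, IsHarmonic j (p ab j))
    (hdec : ∀ ab (U : OddSet n), U.1.card = 2 * c' + 1 →
      (X U - X' U) ab.1 ab.2 = (∑ j ∈ range (2 * c' + 1 + 1), up^[2 * c' + 1 - j] (p ab j)) U.1)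
    (hhigh : ∀ ab j, j ≤ D → p ab j = 0) :
    |∑ U : OddSet n, ∑ M : PMatch n, levelWeight n (2 * c' + 1) C w U M * (X U * Y M).trace -
        ∑ U : OddSet n, ∑ M : PMatch n, levelWeight n (2 * c' + 1) C w U M * (X' U * Y M).trace| ≤
      (∑ c ∈ C, |w c|) *
        Real.sqrt ((∏ i ∈ range (D / 2 + 1), ((2 * i + 1 : ℝ) / ((n : ℝ) - 2 * i))) *
          ((∑ U : OddSet n, if U.1.card = 2 * c' + 1 then ∑ a, ∑ b, (X U - X' U) a b ^ 2 else 0) / (n.choose (2 * c' + 1) : ℝ)) *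
          ((∑ M : PMatch n, ∑ a, ∑ b, Y M a b ^ 2) / (Fintype.card (PMatch n) : ℝ))) := by
  have h := abs_value_le_of_highPass hn hdes hD (fun U => X U - X' U) Y p hp hdec hhigh
  have e : ∑ U : OddSet n, ∑ M : PMatch n, levelWeight n (2 * c' + 1) C w U M * (X U * Y M).trace -
      ∑ U : OddSet n, ∑ M : PMatch n, levelWeight n (2 * c' + 1) C w U M * (X' U * Y M).trace =
      ∑ U : OddSet n, ∑ M : PMatch n, levelWeight n (2 * c' + 1) C w U M * ((X U - X' U) * Y M).trace := by
    rw [← sum_sub_distrib]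
    refine sum_congr rfl fun U _ => ?_
    rw [← sum_sub_distrib]
    refine sum_congr rfl fun M _ => ?_
    rw [Matrix.sub_mul, trace_sub]; ring
  rw [e]; exact h

/-- The Frobenius mass of a difference: `‖X − X'‖² ≤ 2‖X‖² + 2‖X'‖²` entrywise summed. [folklore] -/
theorem frobenius_sub_le {r : ℕ} (P Q : Matrix (Fin r) (Fin r) ℝ) :
    ∑ a, ∑ b, (P - Q) a b ^ 2 ≤ 2 * ∑ a, ∑ b, P a b ^ 2 + 2 * ∑ a, ∑ b, Q a b ^ 2 := by
  rw [mul_sum, mul_sum, ← sum_add_distrib]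
  refine sum_le_sum fun a _ => ?_
  rw [mul_sum, mul_sum, ← sum_add_distrib]
  refine sum_le_sum fun b _ => ?_
  rw [Matrix.sub_apply]
  nlinarith [sq_nonneg (P a b + Q a b)]

/-- **HIGH-PASS EQUIVALENCE FOR CONTRACTION PAIRS**: for psd-contraction fields `X`, `X'`, `Y` with `X − X'` high-pass,
`|value(X,Y) − value(X',Y)| ≤ 2·(Σ_c|w_c|)·r·√P_D`. [cite: Rothvoss2017, §2 (PDF p. 6)] [cite: Grigoriev2001, Lemma 1.4 (PDF p. 8)]
[cite: GriblingDelaatLaurent2019, §5] -/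
theorem value_sub_le_of_highPass_sub_contractions {c' T D r : ℕ} {Bv : ℝ} {C : Finset ℕ} {w : ℕ → ℝ} (hn : Even n)
    (hdes : IsExactDesign n (2 * c' + 1) T D Bv C w) (hD : D ≤ 2 * c')
    (X X' : OddSet n → Matrix (Fin r) (Fin r) ℝ) (hX : ∀ U, (X U).PosSemidef ∧ (1 - X U).PosSemidef)
    (hX' : ∀ U, (X' U).PosSemidef ∧ (1 - X' U).PosSemidef)
    (Y : PMatch n → Matrix (Fin r) (Fin r) ℝ) (hY : ∀ M, (Y M).PosSemidef ∧ (1 - Y M).PosSemidef)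
    (p : Fin r × Fin r → ℕ → Finset (Fin n) → ℝ) (hp : ∀ ab j, IsHarmonic j (p ab j))
    (hdec : ∀ ab (U : OddSet n), U.1.card = 2 * c' + 1 →
      (X U - X' U) ab.1 ab.2 = (∑ j ∈ range (2 * c' + 1 + 1), up^[2 * c' + 1 - j] (p ab j)) U.1)
    (hhigh : ∀ ab j, j ≤ D → p ab j = 0) :
    ∑ U : OddSet n, ∑ M : PMatch n, levelWeight n (2 * c' + 1) C w U M * (X U * Y M).trace ≤
      ∑ U : OddSet n, ∑ M : PMatch n, levelWeight n (2 * c' + 1) C w U M * (X' U * Y M).trace +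
        2 * (∑ c ∈ C, |w c|) * ((r : ℝ) * Real.sqrt (∏ i ∈ range (D / 2 + 1), ((2 * i + 1 : ℝ) / ((n : ℝ) - 2 * i)))) := by
  have ht : 2 * (2 * c' + 1) ≤ n := by have := hdes.2.1; omega
  have h := (abs_le.1 (abs_value_sub_le_of_highPass_sub hn hdes hD X X' Y p hp hdec hhigh)).2
  set PD : ℝ := ∏ i ∈ range (D / 2 + 1), ((2 * i + 1 : ℝ) / ((n : ℝ) - 2 * i)) with hPDdef
  have hPD : 0 ≤ PD := prod_atten_nonneg (n := n) (K := D) (by omega)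
  have hPm : (0 : ℝ) < Fintype.card (PMatch n) := by exact_mod_cast card_pmatch_pos hn
  have hCn : (0 : ℝ) < (n.choose (2 * c' + 1) : ℝ) := by exact_mod_cast Nat.choose_pos (by omega)
  -- Frobenius masses: `N_{X−X'} ≤ 4r·C(n,t)`, `N_Y ≤ r·|PM|`
  have hNX := sum_frobenius_cuts_le ⟨c', rfl⟩ hX
  have hNX' := sum_frobenius_cuts_le ⟨c', rfl⟩ hX'
  have hNE : (∑ U : OddSet n, if U.1.card = 2 * c' + 1 then ∑ a, ∑ b, (X U - X' U) a b ^ 2 else 0) ≤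
      (4 * r : ℝ) * (n.choose (2 * c' + 1) : ℝ) := by
    calc (∑ U : OddSet n, if U.1.card = 2 * c' + 1 then ∑ a, ∑ b, (X U - X' U) a b ^ 2 else 0)
        ≤ ∑ U : OddSet n, (2 * (if U.1.card = 2 * c' + 1 then ∑ a, ∑ b, X U a b ^ 2 else 0) +
            2 * (if U.1.card = 2 * c' + 1 then ∑ a, ∑ b, X' U a b ^ 2 else 0)) := by
          refine sum_le_sum fun U _ => ?_
          split_ifs
          · exact frobenius_sub_le (X U) (X' U)
          · simp
      _ = 2 * (∑ U : OddSet n, if U.1.card = 2 * c' + 1 then ∑ a, ∑ b, X U a b ^ 2 else 0) +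
            2 * (∑ U : OddSet n, if U.1.card = 2 * c' + 1 then ∑ a, ∑ b, X' U a b ^ 2 else 0) := by
          rw [sum_add_distrib, mul_sum, mul_sum]
      _ ≤ 2 * ((r : ℝ) * (n.choose (2 * c' + 1) : ℝ)) + 2 * ((r : ℝ) * (n.choose (2 * c' + 1) : ℝ)) := by linarith
      _ = (4 * r : ℝ) * (n.choose (2 * c' + 1) : ℝ) := by ring
  have hNY := sum_frobenius_matchings_le hY
  -- `√(PD · (N_E/Cn) · (N_Y/Pm)) ≤ √(PD · 4r · r) = 2r·√PD`
  have htail2 : Real.sqrt (PD * ((∑ U : OddSet n, if U.1.card = 2 * c' + 1 then ∑ a, ∑ b, (X U - X' U) a b ^ 2 else 0) /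
        (n.choose (2 * c' + 1) : ℝ)) * ((∑ M : PMatch n, ∑ a, ∑ b, Y M a b ^ 2) / (Fintype.card (PMatch n) : ℝ))) ≤
      2 * ((r : ℝ) * Real.sqrt PD) := by
    have h1 : (∑ U : OddSet n, if U.1.card = 2 * c' + 1 then ∑ a, ∑ b, (X U - X' U) a b ^ 2 else 0) /
        (n.choose (2 * c' + 1) : ℝ) ≤ 4 * r := (div_le_iff₀ hCn).2 hNE
    have h2 : (∑ M : PMatch n, ∑ a, ∑ b, Y M a b ^ 2) / (Fintype.card (PMatch n) : ℝ) ≤ r := (div_le_iff₀ hPm).2 hNY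
    have h2' : 0 ≤ (∑ M : PMatch n, ∑ a, ∑ b, Y M a b ^ 2) / (Fintype.card (PMatch n) : ℝ) :=
      div_nonneg (sum_nonneg fun M _ => by positivity) hPm.le
    calc _ ≤ Real.sqrt (PD * (4 * r) * r) :=
          Real.sqrt_le_sqrt (mul_le_mul (mul_le_mul_of_nonneg_left h1 hPD) h2 h2' (by positivity))
      _ = 2 * ((r : ℝ) * Real.sqrt PD) := by
          rw [show PD * (4 * r) * r = (2 * r) ^ 2 * PD by ring, Real.sqrt_mul (by positivity), Real.sqrt_sq (by positivity)]
          ring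
  have hBv : ∑ c ∈ C, |w c| ≤ Bv := hdes.2.2.2.2.2.2
  have hBv0 : 0 ≤ ∑ c ∈ C, |w c| := sum_nonneg fun c _ => abs_nonneg _
  have := mul_le_mul_of_nonneg_left htail2 hBv0
  rw [hPDdef] at this
  linarith

/-! ### §2 The SIGN cell modulo high harmonics -/

/-- **THE SIGN CELL MODULO HIGH HARMONICS.** For `n` even, an exact design `(n, t = 2c'+1, T, D ≤ 2c', B_v, C, w)`, `D ≤ k ≤ c'`; a
psd-contraction cut field `X` that differs from a Gram contraction `A Aᵀ` (`A` of Johnson degree `≤ k`, `A Aᵀ ⪯ I`) by a HIGH-PASS field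
(`X − A Aᵀ` has a harmonic datum with vanishing layers of degree `≤ D`); and any psd-contraction matching field `Y`:
`value(X,Y) ≤ r·(B_v√P_D + 2^{k+1}√P_k + Σ_{κ∈(D/2,k/2]} R_κ√A_κ) + 2·B_v·r·√P_D`. `X` need not have any low-degree psd Gram minorant
(fourth barrier `GramMinorantLayerEnergy`): only its low layers must be those of one.
[cite: Grigoriev2001, Lemma 1.4 (PDF p. 8)] [cite: Rothvoss2017, §2 (PDF p. 6)] [cite: GriblingDelaatLaurent2019, §5]
[cite: BrouwerHaemers2012, Thm. 4.9.1 (PDF p. 93)] [cite: CoppersmithRivlin1992, Thm. (p. 970)] -/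
theorem value_le_of_lowDegree_add_highPass {c' T D : ℕ} {Bv : ℝ} {C : Finset ℕ} {w : ℕ → ℝ} (hn : Even n)
    (hdes : IsExactDesign n (2 * c' + 1) T D Bv C w) (hD : D ≤ 2 * c') {r m k : ℕ} (hDk : D ≤ k) (hkc : k ≤ c')
    (X : OddSet n → Matrix (Fin r) (Fin r) ℝ) (hX : ∀ U, (X U).PosSemidef ∧ (1 - X U).PosSemidef)
    (A : OddSet n → Matrix (Fin r) (Fin m) ℝ) (hA : IsLowDegreeU n k A) (hA1 : ∀ U, (1 - A U * (A U)ᵀ).PosSemidef)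
    (p : Fin r × Fin r → ℕ → Finset (Fin n) → ℝ) (hp : ∀ ab j, IsHarmonic j (p ab j))
    (hdec : ∀ ab (U : OddSet n), U.1.card = 2 * c' + 1 →
      (X U - A U * (A U)ᵀ) ab.1 ab.2 = (∑ j ∈ range (2 * c' + 1 + 1), up^[2 * c' + 1 - j] (p ab j)) U.1)
    (hhigh : ∀ ab j, j ≤ D → p ab j = 0)
    (Y : PMatch n → Matrix (Fin r) (Fin r) ℝ) (hY : ∀ M, (Y M).PosSemidef ∧ (1 - Y M).PosSemidef) :
    ∑ U, ∑ M, levelWeight n (2 * c' + 1) C w U M * (X U * Y M).trace ≤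
      (r : ℝ) * (Bv * Real.sqrt (∏ i ∈ range (D / 2 + 1), ((2 * i + 1 : ℝ) / ((n : ℝ) - 2 * i))) +
        2 ^ (k + 1) * Real.sqrt (∏ i ∈ range (k / 2 + 1), ((2 * i + 1 : ℝ) / ((n : ℝ) - 2 * i))) +
        ∑ κ ∈ Ico (D / 2 + 1) (k / 2 + 1),
          (∏ i ∈ range κ, (((2 * c' + 1 : ℝ) - 2 * i) * ((n : ℝ) - 2 * c' - 1 - 2 * i) /
              (((2 * c' : ℝ) - 2 * i) * ((n : ℝ) - 2 * c' - 2 - 2 * i)))) *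
            Real.sqrt (∏ i ∈ range κ, ((2 * i + 1 : ℝ) / ((n : ℝ) - 2 * i)))) +
      2 * Bv * ((r : ℝ) * Real.sqrt (∏ i ∈ range (D / 2 + 1), ((2 * i + 1 : ℝ) / ((n : ℝ) - 2 * i)))) := by
  have hGpsd : ∀ U : OddSet n, (A U * (A U)ᵀ).PosSemidef := fun U => by
    simpa [Matrix.conjTranspose_eq_transpose_of_trivial] using Matrix.posSemidef_self_mul_conjTranspose (A U)
  have hsign := value_le_of_lowDegree_allModes_sharp hn hdes hD hDk hkc A hA hA1 Y hY
  have hequiv := value_sub_le_of_highPass_sub_contractions hn hdes hD X (fun U => A U * (A U)ᵀ) hX (fun U => ⟨hGpsd U, hA1 U⟩) Y hY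
    p hp hdec hhigh
  have hBv : ∑ c ∈ C, |w c| ≤ Bv := hdes.2.2.2.2.2.2
  have hr0 : 0 ≤ (r : ℝ) * Real.sqrt (∏ i ∈ range (D / 2 + 1), ((2 * i + 1 : ℝ) / ((n : ℝ) - 2 * i))) := by positivity
  have := mul_le_mul_of_nonneg_right hBv hr0
  nlinarith [hsign, hequiv, this]

end Summit.PneNP.PneNP.Theorems.ChebyshevTracialDesignHighPassInvisible

end
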